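import Summits.QuantumFields.YangMills.Theorems.UnitScaleTiltProp7CovariantCurlOfGrad
import Literature.MathematicalPhysics.QuantumFieldTheory.Balaban1983to89.B9Thm310CommutatorDataOfPlaquettes
import Literature.MathematicalPhysics.QuantumFieldTheory.Balaban1983to89.B9Ineq373HessianPieceBoundsY
import HarnessLib

/-!
# Route `UnitScaleTilt`, crux K1 «MinimiserStabilityRegPr» (stmt-QuantumFields-19200), route-R E′ path (α′), S2 = P-cov2 (the COVARIANT (hK)), brick (D1-cov) FILE A —
# FRAMED SECOND COVARIANT DIFFERENCES: in a local frame `Fr`, the covariant second difference `D_{U,ν}D_{U,μ}e` IS the covariant second difference of the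
# framed field `v = R(Fr⁻¹)e` at the framed background `h_μ(z) = Fr(z)⁻¹·U_μ(z)·Fr(z + e_μ)` (exact), and the FLAT second difference of `v` differs from it by
# `2τ₁·(first covariant differences) + (2τ₂ + 4τ₁²)·(zeroth order)` when `‖h − 1‖ ≤ τ₁`, `‖h_μ(z + e_ν) − h_μ(z)‖ ≤ τ₂` — a FRAME-FREE right side

Cell `ym3-torus`, extra width seat `ym-routeR-w6` (gen 6); LOCATE `ym-routeR-w6/LOCATE-PCOV2-routeRw6g6.md` (19200 evidence #42) §2 STEP 2.  THEOREMS ONLY (0 `def`,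
0 `sorry`); `--supports stmt-QuantumFields-19200`, count-neutral.  YM₃ on T³ is a ladder rung (R3), not the Clay problem; nothing here claims a stub, the crux, d = 4 or
the mass gap.

WHY (the point of the brick).  The covariant centre-pinned `H²` Poincaré inequality (D1-cov) — `Σ‖e‖² ≤ C·ℓ⁴·Σ‖Δ_Ue‖²` for fields vanishing on the `k`-centres at a small-field
background — is proved per corner-cell by the FLAT vertex-pinned Morrey cell lemma (✓ `Prop7VertexPinnedMorreyCell`) applied to the framed field in a (3.35) frame; to sum
the cells with the flat bookkeeping of ✓ `Prop7CentrePinnedHessianPoincare` the per-cell right side must not mention the frame.  This file supplies exactly that: the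
flat Hessian of the framed field is bounded POINTWISE by gauge-invariant quantities of `e` (bi-contractivity of the frame), with the junk organised so that `τ₁ ≍ e∕ℓ`
multiplies FIRST covariant differences and only `τ₂ ≍ e∕ℓ²` (and `τ₁²`) multiplies the field itself — the grouping under which every `ℓ` cancels in (D1-cov).

WHAT IS PROVED (ns `…Theorems.Prop7FramedSecondDifference`; abstract carrier: sites `S`, directions `ι`, shifts `T : ι → Equiv.Perm S`, background `U : ι → S → 𝔸ˣ`,
frame `Fr : S → 𝔸ˣ`; `R U X = U X U⁻¹`, `covD` of ✓ `B9Eq39Adjoint`).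
* §1 (any ring) ★ `R_inv_frame_covD` — `R(Fr x)⁻¹ (D_{U,μ}e)(x) = D_{h,μ}(R(Fr⁻¹)e)(x)`, `h_μ(z) := Fr(z)⁻¹·U_μ(z)·Fr(T_μ z)` (gauge covariance of `D_U` under a frame);
  ★ `R_inv_frame_covD_covD` — the same for `D_{U,ν}D_{U,μ}`.
* §2 (normed ring, bi-contractive units; `‖R(A)X − R(B)X‖ ≤ 2‖A − B‖·‖X‖` is ✓ `B9Ineq373HessianPieceBoundsY.norm_R_sub_R_le`) `norm_mul_sub_one_le` (`‖AB − 1‖ ≤ ‖A − 1‖ + ‖B − 1‖`),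
  ★ `norm_covD_sub_fdiff_le` (`‖D_{V,μ}v(x) − (v(T_μx) − v(x))‖ ≤ 2‖V_μ(x) − 1‖·‖v(T_μx)‖`),
  ★★ `norm_covD_covD_sub_sdiff_le` — for commuting shifts at `x`:
  `‖D_{V,ν}D_{V,μ}v(x) − [(v(T_μT_νx) − v(T_νx)) − (v(T_μx) − v(x))]‖ ≤ 2τ₁‖D_{V,μ}v(T_νx)‖ + 2τ₁‖D_{V,ν}v(T_μx)‖ + (2τ₂ + 4τ₁²)‖v(T_μT_νx)‖`
  under `‖V_ν(x) − 1‖, ‖V_μ(x) − 1‖, ‖V_ν(T_μx) − 1‖ ≤ τ₁` and `‖V_μ(T_νx) − V_μ(x)‖ ≤ τ₂`.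
* §3 ★★★ `norm_sdiff_framed_le` ∕ `norm_sq_sdiff_framed_le` — with `v := R(Fr⁻¹)e` and the framed background `h`: the flat second difference of `v` at `x` is bounded by
  `‖D_{U,ν}D_{U,μ}e(x)‖ + 2τ₁(‖D_{U,μ}e(T_νx)‖ + ‖D_{U,ν}e(T_μx)‖) + (2τ₂ + 4τ₁²)‖e(T_μT_νx)‖`, and its square by `4·(squares)` — NO frame on the right.
HONEST SCOPE.  Pointwise algebra and norm bookkeeping only; the frames and their rows (from [Balaban1985BackgroundPropagators] (3.35) cube gauges, ✓ `Prop7ConjFrameReg335`,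
✓ `Prop7LemmaHCurvedFramesOfReg335`) stay hypotheses; the cell∕torus assembly (D1-cov) is FILE B.

References: T. Bałaban, CMP 99 (1985) 389–434 [Balaban1985BackgroundPropagators] ((3.3) p.390, (3.28) p.395, (3.35) p.396); CMP 102 (1985) 277–309 [Balaban1985Variational]
(Prop. 7 p.299); M. Giaquinta, *Multiple integrals…*, Princeton 1983 [Giaquinta1984] (Ch. III §1).
-/

set_option autoImplicit false

noncomputable section

namespace Summit.QuantumFields.YangMills.Theorems.Prop7FramedSecondDifference

open Literature.MathematicalPhysics.QuantumFieldTheory.Balaban1983to89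
open B9Eq39Adjoint (R R_sub covD)
open B11Eq135Weitzenbock (norm_R_sub_self_le)
open B9Eq310Hermitian (norm_R_le)
open B9Thm310CommutatorDataOfPlaquettes (bicontr_mul bicontr_inv)
open B9Ineq373HessianPieceBoundsY (norm_R_sub_R_le)

/-! ## §1 Gauge covariance of `D_U` and `D_UD_U` under a frame (any ring) -/

section RingLevel

variable {𝔸 : Type*} [Ring 𝔸] {S : Type*} {ι : Type*} (T : ι → Equiv.Perm S) (U : ι → S → 𝔸ˣ) (Fr : S → 𝔸ˣ)

/-- ★ **GAUGE COVARIANCE OF `D_U` UNDER A FRAME**: `R(Fr x)⁻¹ (D_{U,μ}e)(x) = D_{h,μ}v(x)` for the framed field `v = R(Fr⁻¹)e` and the framed background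
`h_μ(z) = Fr(z)⁻¹·U_μ(z)·Fr(T_μ z)` ((3.28): the gauge-transformed bond variables). [cite: Balaban1985BackgroundPropagators, (3.28) p.395, (3.3) p.390] -/
theorem R_inv_frame_covD (e : S → 𝔸) (μ : ι) (x : S) :
    R (Fr x)⁻¹ (covD T U μ e x)
      = covD T (fun κ z => (Fr z)⁻¹ * U κ z * Fr (T κ z)) μ (fun z => R (Fr z)⁻¹ (e z)) x := by
  show R (Fr x)⁻¹ (R (U μ x) (e (T μ x)) - e x)
      = R ((Fr x)⁻¹ * U μ x * Fr (T μ x)) (R (Fr (T μ x))⁻¹ (e (T μ x))) - R (Fr x)⁻¹ (e x)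
  rw [R_sub, ← B9Eq39Adjoint.R_mul, ← B9Eq39Adjoint.R_mul, mul_inv_cancel_right]

/-- ★ **GAUGE COVARIANCE OF `D_UD_U` UNDER A FRAME**: `R(Fr x)⁻¹ (D_{U,ν}D_{U,μ}e)(x) = D_{h,ν}D_{h,μ}v(x)`. [cite: Balaban1985BackgroundPropagators, (3.28) p.395, (3.3) p.390] -/
theorem R_inv_frame_covD_covD (e : S → 𝔸) (μ ν : ι) (x : S) :
    R (Fr x)⁻¹ (covD T U ν (covD T U μ e) x)
      = covD T (fun κ z => (Fr z)⁻¹ * U κ z * Fr (T κ z)) ν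
          (covD T (fun κ z => (Fr z)⁻¹ * U κ z * Fr (T κ z)) μ (fun z => R (Fr z)⁻¹ (e z))) x := by
  rw [R_inv_frame_covD]
  congr 1
  funext z
  exact R_inv_frame_covD T U Fr e μ z

end RingLevel

/-! ## §2 Norm bookkeeping at a background near `1` with small differences (normed ring, bi-contractive units) -/

section NormLevel

variable {𝔸 : Type} [NormedRing 𝔸] {S : Type*} {ι : Type*} (T : ι → Equiv.Perm S)

omit T in
/-- `‖AB − 1‖ ≤ ‖A − 1‖ + ‖B − 1‖` for units with `‖B‖ ≤ 1` (`AB − 1 = (A − 1)B + (B − 1)`). [folklore] -/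
theorem norm_mul_sub_one_le {A B : 𝔸ˣ} (hB : ‖(B : 𝔸)‖ ≤ 1) :
    ‖((A * B : 𝔸ˣ) : 𝔸) - 1‖ ≤ ‖(A : 𝔸) - 1‖ + ‖(B : 𝔸) - 1‖ := by
  have e : ((A * B : 𝔸ˣ) : 𝔸) - 1 = ((A : 𝔸) - 1) * (B : 𝔸) + ((B : 𝔸) - 1) := by
    rw [Units.val_mul]; noncomm_ring
  rw [e]
  calc _ ≤ ‖((A : 𝔸) - 1) * (B : 𝔸)‖ + ‖(B : 𝔸) - 1‖ := norm_add_le _ _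
    _ ≤ ‖(A : 𝔸) - 1‖ * ‖(B : 𝔸)‖ + ‖(B : 𝔸) - 1‖ := by gcongr; exact norm_mul_le _ _
    _ ≤ ‖(A : 𝔸) - 1‖ * 1 + ‖(B : 𝔸) - 1‖ := by gcongr
    _ = ‖(A : 𝔸) - 1‖ + ‖(B : 𝔸) - 1‖ := by rw [mul_one]

variable (V : ι → S → 𝔸ˣ)

/-- ★ **FIRST ORDER**: the covariant difference differs from the flat forward difference by `2‖V_μ(x) − 1‖·‖v(T_μx)‖`:
`‖D_{V,μ}v(x) − (v(T_μx) − v(x))‖ ≤ 2‖V_μ(x) − 1‖·‖v(T_μx)‖` (only `‖V_μ(x)⁻¹‖ ≤ 1` is used). [cite: Balaban1985BackgroundPropagators, (3.3) p.390, (3.35) p.396] -/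
theorem norm_covD_sub_fdiff_le (v : S → 𝔸) (μ : ι) (x : S) (hV : ‖(((V μ x)⁻¹ : 𝔸ˣ) : 𝔸)‖ ≤ 1) :
    ‖covD T V μ v x - (v (T μ x) - v x)‖ ≤ 2 * ‖((V μ x : 𝔸ˣ) : 𝔸) - 1‖ * ‖v (T μ x)‖ := by
  have e : covD T V μ v x - (v (T μ x) - v x) = R (V μ x) (v (T μ x)) - v (T μ x) := by
    simp only [covD]; abel
  rw [e]
  exact norm_R_sub_self_le hV _

/-- ★★ **SECOND ORDER** (commuting shifts at `x`): with `τ₁` bounding `‖V_ν(x) − 1‖, ‖V_μ(x) − 1‖, ‖V_ν(T_μx) − 1‖` and `τ₂` bounding the transverse difference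
`‖V_μ(T_νx) − V_μ(x)‖`, the covariant second difference differs from the flat one by FIRST covariant differences times `2τ₁` plus the field times `2τ₂ + 4τ₁²`:
`‖D_{V,ν}D_{V,μ}v(x) − [(v(T_μT_νx) − v(T_νx)) − (v(T_μx) − v(x))]‖ ≤ 2τ₁‖D_{V,μ}v(T_νx)‖ + 2τ₁‖D_{V,ν}v(T_μx)‖ + (2τ₂ + 4τ₁²)‖v(T_μT_νx)‖`.
Proof: `D_νD_μv(x) = [D_μv(T_νx) − D_μv(x)] + [R(V_νx) − 1](D_μv(T_νx))`, `D_μv = ∂_μv + E_μ`, `E_μ(T_νx) − E_μ(x) = [R(V_μ(T_νx)) − R(V_μx)]v(T_μT_νx) + [R(V_μx) − 1]∂_νv(T_μx)`.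
[cite: Balaban1985BackgroundPropagators, (3.3) p.390, (3.35) p.396] -/
theorem norm_covD_covD_sub_sdiff_le (hV : ∀ (κ : ι) (y : S), ‖(V κ y : 𝔸)‖ ≤ 1 ∧ ‖(((V κ y)⁻¹ : 𝔸ˣ) : 𝔸)‖ ≤ 1)
    (v : S → 𝔸) (μ ν : ι) (x : S) (hT : T μ (T ν x) = T ν (T μ x)) {τ₁ τ₂ : ℝ}
    (h1ν : ‖((V ν x : 𝔸ˣ) : 𝔸) - 1‖ ≤ τ₁) (h1μ : ‖((V μ x : 𝔸ˣ) : 𝔸) - 1‖ ≤ τ₁) (h1ν' : ‖((V ν (T μ x) : 𝔸ˣ) : 𝔸) - 1‖ ≤ τ₁)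
    (h2 : ‖((V μ (T ν x) : 𝔸ˣ) : 𝔸) - (V μ x : 𝔸ˣ)‖ ≤ τ₂) :
    ‖covD T V ν (covD T V μ v) x - ((v (T μ (T ν x)) - v (T ν x)) - (v (T μ x) - v x))‖
      ≤ 2 * τ₁ * ‖covD T V μ v (T ν x)‖ + 2 * τ₁ * ‖covD T V ν v (T μ x)‖ + (2 * τ₂ + 4 * τ₁ ^ 2) * ‖v (T μ (T ν x))‖ := by
  have hτ₁ : 0 ≤ τ₁ := (norm_nonneg _).trans h1ν
  -- the three pieces
  set X := covD T V μ v (T ν x) with hX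
  set w := v (T μ (T ν x)) with hw
  have e : covD T V ν (covD T V μ v) x - ((v (T μ (T ν x)) - v (T ν x)) - (v (T μ x) - v x))
      = (R (V ν x) X - X)
        + (R (V μ (T ν x)) w - R (V μ x) w)
        + (R (V μ x) (v (T ν (T μ x)) - v (T μ x)) - (v (T ν (T μ x)) - v (T μ x))) := by
    simp only [hX, hw, covD, R_sub, hT]
    abel
  rw [e]
  have hA : ‖R (V ν x) X - X‖ ≤ 2 * τ₁ * ‖X‖ :=
    (norm_R_sub_self_le (hV ν x).2 X).trans (by gcongr)
  have hB : ‖R (V μ (T ν x)) w - R (V μ x) w‖ ≤ 2 * τ₂ * ‖w‖ :=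
    (norm_R_sub_R_le (hV μ (T ν x)) (hV μ x) w).trans (by gcongr)
  -- the flat `ν`-difference at `T_μ x` is the covariant one minus its defect
  have hC0 : ‖v (T ν (T μ x)) - v (T μ x)‖ ≤ ‖covD T V ν v (T μ x)‖ + 2 * τ₁ * ‖w‖ := by
    have hd := norm_covD_sub_fdiff_le T V v ν (T μ x) (hV ν (T μ x)).2
    have hw' : v (T ν (T μ x)) = w := by rw [hw, hT]
    rw [hw'] at hd ⊢
    have := norm_sub_le_norm_sub_add_norm_sub (covD T V ν v (T μ x)) (covD T V ν v (T μ x) - (w - v (T μ x))) (0 : 𝔸)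
    calc ‖w - v (T μ x)‖ = ‖covD T V ν v (T μ x) - (covD T V ν v (T μ x) - (w - v (T μ x)))‖ := by rw [sub_sub_cancel]
      _ ≤ ‖covD T V ν v (T μ x)‖ + ‖covD T V ν v (T μ x) - (w - v (T μ x))‖ := norm_sub_le _ _
      _ ≤ ‖covD T V ν v (T μ x)‖ + 2 * ‖((V ν (T μ x) : 𝔸ˣ) : 𝔸) - 1‖ * ‖w‖ := by gcongr
      _ ≤ ‖covD T V ν v (T μ x)‖ + 2 * τ₁ * ‖w‖ := by gcongr
  have hC : ‖R (V μ x) (v (T ν (T μ x)) - v (T μ x)) - (v (T ν (T μ x)) - v (T μ x))‖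
      ≤ 2 * τ₁ * ‖covD T V ν v (T μ x)‖ + 4 * τ₁ ^ 2 * ‖w‖ := by
    calc _ ≤ 2 * ‖((V μ x : 𝔸ˣ) : 𝔸) - 1‖ * ‖v (T ν (T μ x)) - v (T μ x)‖ := norm_R_sub_self_le (hV μ x).2 _
      _ ≤ 2 * τ₁ * (‖covD T V ν v (T μ x)‖ + 2 * τ₁ * ‖w‖) := by gcongr
      _ = 2 * τ₁ * ‖covD T V ν v (T μ x)‖ + 4 * τ₁ ^ 2 * ‖w‖ := by ring
  calc _ ≤ ‖R (V ν x) X - X + (R (V μ (T ν x)) w - R (V μ x) w)‖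
          + ‖R (V μ x) (v (T ν (T μ x)) - v (T μ x)) - (v (T ν (T μ x)) - v (T μ x))‖ := norm_add_le _ _
    _ ≤ (‖R (V ν x) X - X‖ + ‖R (V μ (T ν x)) w - R (V μ x) w‖)
          + ‖R (V μ x) (v (T ν (T μ x)) - v (T μ x)) - (v (T ν (T μ x)) - v (T μ x))‖ := by gcongr; exact norm_add_le _ _
    _ ≤ (2 * τ₁ * ‖X‖ + 2 * τ₂ * ‖w‖) + (2 * τ₁ * ‖covD T V ν v (T μ x)‖ + 4 * τ₁ ^ 2 * ‖w‖) := by gcongr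
    _ = 2 * τ₁ * ‖X‖ + 2 * τ₁ * ‖covD T V ν v (T μ x)‖ + (2 * τ₂ + 4 * τ₁ ^ 2) * ‖w‖ := by ring

end NormLevel

/-! ## §3 ★★★ The flat second difference of the framed field, bounded WITHOUT the frame -/

section Framed

variable {𝔸 : Type} [NormedRing 𝔸] {S : Type*} {ι : Type*} (T : ι → Equiv.Perm S) (U : ι → S → 𝔸ˣ) (Fr : S → 𝔸ˣ)

/-- ★★★ **THE FLAT HESSIAN OF THE FRAMED FIELD, FRAME-FREE**: `U` bi-contractive, `Fr` bi-contractive at the four sites `x, T_μx, T_νx, T_μT_νx`, shifts commuting at `x`,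
framed background `h_κ(z) = Fr(z)⁻¹U_κ(z)Fr(T_κz)` with `‖h_ν(x) − 1‖, ‖h_μ(x) − 1‖, ‖h_ν(T_μx) − 1‖ ≤ τ₁` and `‖h_μ(T_νx) − h_μ(x)‖ ≤ τ₂`; then for `v = R(Fr⁻¹)e`:
`‖(v(T_μT_νx) − v(T_νx)) − (v(T_μx) − v(x))‖ ≤ ‖D_{U,ν}D_{U,μ}e(x)‖ + 2τ₁‖D_{U,μ}e(T_νx)‖ + 2τ₁‖D_{U,ν}e(T_μx)‖ + (2τ₂ + 4τ₁²)‖e(T_μT_νx)‖`.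
[cite: Balaban1985BackgroundPropagators, (3.28) p.395, (3.35) p.396; Giaquinta1984, Ch. III §1] -/
theorem norm_sdiff_framed_le (hU : ∀ (κ : ι) (y : S), ‖(U κ y : 𝔸)‖ ≤ 1 ∧ ‖(((U κ y)⁻¹ : 𝔸ˣ) : 𝔸)‖ ≤ 1)
    (hFr : ∀ z : S, ‖(Fr z : 𝔸)‖ ≤ 1 ∧ ‖(((Fr z)⁻¹ : 𝔸ˣ) : 𝔸)‖ ≤ 1)
    (e : S → 𝔸) (μ ν : ι) (x : S) (hT : T μ (T ν x) = T ν (T μ x)) {τ₁ τ₂ : ℝ}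
    (h1ν : ‖(((Fr x)⁻¹ * U ν x * Fr (T ν x) : 𝔸ˣ) : 𝔸) - 1‖ ≤ τ₁)
    (h1μ : ‖(((Fr x)⁻¹ * U μ x * Fr (T μ x) : 𝔸ˣ) : 𝔸) - 1‖ ≤ τ₁)
    (h1ν' : ‖(((Fr (T μ x))⁻¹ * U ν (T μ x) * Fr (T ν (T μ x)) : 𝔸ˣ) : 𝔸) - 1‖ ≤ τ₁)
    (h2 : ‖(((Fr (T ν x))⁻¹ * U μ (T ν x) * Fr (T μ (T ν x)) : 𝔸ˣ) : 𝔸) - (((Fr x)⁻¹ * U μ x * Fr (T μ x) : 𝔸ˣ) : 𝔸)‖ ≤ τ₂) :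
    ‖(R (Fr (T μ (T ν x)))⁻¹ (e (T μ (T ν x))) - R (Fr (T ν x))⁻¹ (e (T ν x))) - (R (Fr (T μ x))⁻¹ (e (T μ x)) - R (Fr x)⁻¹ (e x))‖
      ≤ ‖covD T U ν (covD T U μ e) x‖ + 2 * τ₁ * ‖covD T U μ e (T ν x)‖ + 2 * τ₁ * ‖covD T U ν e (T μ x)‖
        + (2 * τ₂ + 4 * τ₁ ^ 2) * ‖e (T μ (T ν x))‖ := by
  have hτ₁ : 0 ≤ τ₁ := (norm_nonneg _).trans h1ν
  have hτ₂ : 0 ≤ τ₂ := (norm_nonneg _).trans h2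
  -- the framed background is bi-contractive
  have hh : ∀ (κ : ι) (y : S), ‖(((Fr y)⁻¹ * U κ y * Fr (T κ y) : 𝔸ˣ) : 𝔸)‖ ≤ 1
      ∧ ‖((((Fr y)⁻¹ * U κ y * Fr (T κ y))⁻¹ : 𝔸ˣ) : 𝔸)‖ ≤ 1 := fun κ y =>
    bicontr_mul (bicontr_mul (bicontr_inv (hFr y)) (hU κ y)) (hFr (T κ y))
  set h : ι → S → 𝔸ˣ := fun κ z => (Fr z)⁻¹ * U κ z * Fr (T κ z) with hh'
  set v : S → 𝔸 := fun z => R (Fr z)⁻¹ (e z) with hv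
  have hmain := norm_covD_covD_sub_sdiff_le T h hh v μ ν x hT h1ν h1μ h1ν' h2
  -- the covariant quantities of `v` at `h` are the framed covariant quantities of `e` (§1), of no larger norm
  have e2 : covD T h ν (covD T h μ v) x = R (Fr x)⁻¹ (covD T U ν (covD T U μ e) x) := (R_inv_frame_covD_covD T U Fr e μ ν x).symm
  have e1a : covD T h μ v (T ν x) = R (Fr (T ν x))⁻¹ (covD T U μ e (T ν x)) := (R_inv_frame_covD T U Fr e μ (T ν x)).symm
  have e1b : covD T h ν v (T μ x) = R (Fr (T μ x))⁻¹ (covD T U ν e (T μ x)) := (R_inv_frame_covD T U Fr e ν (T μ x)).symm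
  have n2 : ‖covD T h ν (covD T h μ v) x‖ ≤ ‖covD T U ν (covD T U μ e) x‖ := by
    rw [e2]; exact norm_R_le (hFr x).2 (by rw [inv_inv]; exact (hFr x).1) _
  have n1a : ‖covD T h μ v (T ν x)‖ ≤ ‖covD T U μ e (T ν x)‖ := by
    rw [e1a]; exact norm_R_le (hFr _).2 (by rw [inv_inv]; exact (hFr _).1) _
  have n1b : ‖covD T h ν v (T μ x)‖ ≤ ‖covD T U ν e (T μ x)‖ := by
    rw [e1b]; exact norm_R_le (hFr _).2 (by rw [inv_inv]; exact (hFr _).1) _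
  have n0 : ‖v (T μ (T ν x))‖ ≤ ‖e (T μ (T ν x))‖ := norm_R_le (hFr _).2 (by rw [inv_inv]; exact (hFr _).1) _
  have hflat : ‖(v (T μ (T ν x)) - v (T ν x)) - (v (T μ x) - v x)‖
      ≤ ‖covD T h ν (covD T h μ v) x‖ + ‖covD T h ν (covD T h μ v) x - ((v (T μ (T ν x)) - v (T ν x)) - (v (T μ x) - v x))‖ := by
    calc ‖(v (T μ (T ν x)) - v (T ν x)) - (v (T μ x) - v x)‖
        = ‖covD T h ν (covD T h μ v) x - (covD T h ν (covD T h μ v) x - ((v (T μ (T ν x)) - v (T ν x)) - (v (T μ x) - v x)))‖ := by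
          rw [sub_sub_cancel]
      _ ≤ _ := norm_sub_le _ _
  calc ‖(v (T μ (T ν x)) - v (T ν x)) - (v (T μ x) - v x)‖
      ≤ ‖covD T h ν (covD T h μ v) x‖ + (2 * τ₁ * ‖covD T h μ v (T ν x)‖ + 2 * τ₁ * ‖covD T h ν v (T μ x)‖
          + (2 * τ₂ + 4 * τ₁ ^ 2) * ‖v (T μ (T ν x))‖) := hflat.trans (by gcongr)
    _ ≤ ‖covD T U ν (covD T U μ e) x‖ + (2 * τ₁ * ‖covD T U μ e (T ν x)‖ + 2 * τ₁ * ‖covD T U ν e (T μ x)‖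
          + (2 * τ₂ + 4 * τ₁ ^ 2) * ‖e (T μ (T ν x))‖) := by gcongr
    _ = _ := by ring

/-- ★★★ **SQUARED FORM** of ✓ `norm_sdiff_framed_le` (the shape the cell∕torus bookkeeping of (D1-cov) sums): the flat Hessian entry of the framed field squared is at most
`4·(‖D_{U,ν}D_{U,μ}e(x)‖² + 4τ₁²‖D_{U,μ}e(T_νx)‖² + 4τ₁²‖D_{U,ν}e(T_μx)‖² + (2τ₂ + 4τ₁²)²‖e(T_μT_νx)‖²)` — four nonnegative FRAME-FREE site quantities of `e`.
[cite: Balaban1985BackgroundPropagators, (3.28) p.395, (3.35) p.396; Giaquinta1984, Ch. III §1] -/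
theorem norm_sq_sdiff_framed_le (hU : ∀ (κ : ι) (y : S), ‖(U κ y : 𝔸)‖ ≤ 1 ∧ ‖(((U κ y)⁻¹ : 𝔸ˣ) : 𝔸)‖ ≤ 1)
    (hFr : ∀ z : S, ‖(Fr z : 𝔸)‖ ≤ 1 ∧ ‖(((Fr z)⁻¹ : 𝔸ˣ) : 𝔸)‖ ≤ 1)
    (e : S → 𝔸) (μ ν : ι) (x : S) (hT : T μ (T ν x) = T ν (T μ x)) {τ₁ τ₂ : ℝ}
    (h1ν : ‖(((Fr x)⁻¹ * U ν x * Fr (T ν x) : 𝔸ˣ) : 𝔸) - 1‖ ≤ τ₁)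
    (h1μ : ‖(((Fr x)⁻¹ * U μ x * Fr (T μ x) : 𝔸ˣ) : 𝔸) - 1‖ ≤ τ₁)
    (h1ν' : ‖(((Fr (T μ x))⁻¹ * U ν (T μ x) * Fr (T ν (T μ x)) : 𝔸ˣ) : 𝔸) - 1‖ ≤ τ₁)
    (h2 : ‖(((Fr (T ν x))⁻¹ * U μ (T ν x) * Fr (T μ (T ν x)) : 𝔸ˣ) : 𝔸) - (((Fr x)⁻¹ * U μ x * Fr (T μ x) : 𝔸ˣ) : 𝔸)‖ ≤ τ₂) :
    ‖(R (Fr (T μ (T ν x)))⁻¹ (e (T μ (T ν x))) - R (Fr (T ν x))⁻¹ (e (T ν x))) - (R (Fr (T μ x))⁻¹ (e (T μ x)) - R (Fr x)⁻¹ (e x))‖ ^ 2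
      ≤ 4 * (‖covD T U ν (covD T U μ e) x‖ ^ 2 + 4 * τ₁ ^ 2 * ‖covD T U μ e (T ν x)‖ ^ 2 + 4 * τ₁ ^ 2 * ‖covD T U ν e (T μ x)‖ ^ 2
        + (2 * τ₂ + 4 * τ₁ ^ 2) ^ 2 * ‖e (T μ (T ν x))‖ ^ 2) := by
  have h := norm_sdiff_framed_le T U Fr hU hFr e μ ν x hT h1ν h1μ h1ν' h2
  have h0 : 0 ≤ ‖(R (Fr (T μ (T ν x)))⁻¹ (e (T μ (T ν x))) - R (Fr (T ν x))⁻¹ (e (T ν x))) - (R (Fr (T μ x))⁻¹ (e (T μ x)) - R (Fr x)⁻¹ (e x))‖ :=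
    norm_nonneg _
  have hsq := pow_le_pow_left₀ h0 h 2
  refine hsq.trans ?_
  -- `(a + b + c + d)² ≤ 4(a² + b² + c² + d²)`
  have h4 : ∀ a b c d : ℝ, (a + b + c + d) ^ 2 ≤ 4 * (a ^ 2 + b ^ 2 + c ^ 2 + d ^ 2) := fun a b c d => by
    nlinarith [sq_nonneg (a - b), sq_nonneg (a - c), sq_nonneg (a - d), sq_nonneg (b - c), sq_nonneg (b - d), sq_nonneg (c - d)]
  refine (h4 _ _ _ _).trans (le_of_eq ?_)
  ring

end Framed


end Summit.QuantumFields.YangMills.Theorems.Prop7FramedSecondDifference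

end
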